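import Literature.MathematicalPhysics.QuantumFieldTheory.Balaban1983to89.B9Eq3153FrakGVariational
import Literature.MathematicalPhysics.QuantumFieldTheory.Balaban1983to89.B9Eq386GreenLipschitzEnergy
import Literature.MathematicalPhysics.QuantumFieldTheory.Balaban1983to89.B9Eq3126H1LipschitzEnergy

/-!
# `Balaban1983to89.B9Eq3153FrakGLipschitzEnergy` — T. Bałaban, *Propagators for lattice gauge theories in a background field*, Commun. Math. Phys. **99**
# (1985) 389–434 [Balaban1985BackgroundPropagators] (3.153) p. 426 *«𝔊 = G₁ − G₁Q*(QG₁Q*)⁻¹QG₁ − G₁DRD*G₁»* with Thm 3.13 p. 426 and Thm 3.4 p. 400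
# *«small perturbations of the operators depending on U only»*: **THE THIRD GREEN'S LETTER `𝔊` IS LIPSCHITZ IN THE DATA IN THE ENERGY NORM — `‖P(𝔊¹x − 𝔊⁰x)‖`
# FROM ITS SEVEN PIECES, EVERY PIECE A FORM LETTER (coercivities, form defect, averaging ∕ projection ∕ derivative remainders, the two `(QG₁Q†)⁻¹`
# letters); NO OPERATOR BOUND OF `Δ_a`, `D`, `Δ_a¹ − Δ_a⁰`, NO NEUMANN SERIES** (abstract finite-dimensional `𝕜`-Hilbert letters)

statement-level skeleton of published theorems with citation tags; proofs where landed; nothing here is a claim about the Yang–Mills mass gap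

CITATION HEADER (lean-in-tree rule).  Audit cell `pub-balaban`, sub-cell `t4`, BINDER row NE9; filed by the row OWNER lineage `b2b-balaban-t4-ne9-p1`
(gen 86), the seventh file of the programme «THE 𝔊-STOREY IN THE ENERGY CURRENCY».  Sources READ first-hand in the held text layer
[Balaban1985BackgroundPropagators] (`paper:balaban1985-cmp99-background-propagators`, journal page = PDF page + 388) p. 426 ((3.153), Thm 3.13), p. 400
(Thm 3.4), p. 407 ((3.84)–(3.86)), p. 416 (Thm 3.11); [Balaban1985Variational] (45) p. 285.  THE PRINT (verbatim, p. 426): *«𝔊 = G₁ − G₁Q*(QG₁Q*)⁻¹QG₁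
− G₁DRD*G₁ … Theorems 3.3, 3.11 hold for 𝔊»*; p. 400 Thm 3.4: the operators are *«analytic functions of U»* on the window — the Lipschitz-at-the-flat-point
shadow is what the chart of `cur U` consumes.

WHAT IS PROVED (sorry-free; 0 `def`; [folklore] algebra; nothing of [B9]∕[B11] asserted as printed).
* §1 (plain normed `𝕜`-spaces; two families of letters `i = 0, 1`: `Gᵢ : E → E`, `Hᵢ : F → E`, `Qᵢ : E → F`, `Dᵢ : S → E`, `Rᵢ : S → S`, `D*ᵢ : E → S`, a weight
  `N ≥ ‖·‖` on `E`, an operator `P` with `‖Pw‖ ≤ N(w)`) **`norm_apply_frakG_sub_le_of_pieces`** — with `𝔊ᵢx := Gᵢx − Hᵢ(Qᵢ(Gᵢx)) − Gᵢ(Dᵢ(Rᵢ(D*ᵢ(Gᵢx))))`,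
  `‖P(𝔊¹x − 𝔊⁰x)‖ ≤ (ε_G g₀ + L_H M_Q g₁ + h₀(δ_Q g₁ + M_Q ε_G g₀) + a₁(δ_P g₁ + M_P ε_G g₀) + (g₁δ_D M_R + χδ_R + ε_G w₀)M_P g₀)·‖x‖` from the piece letters
  `N(G⁰y − G¹y) ≤ ε_G N(G⁰y)`, `N(Gᵢy) ≤ gᵢ‖y‖`, `‖P(H¹b − H⁰b)‖ ≤ L_H‖b‖`, `N(H⁰c) ≤ h₀‖c‖`, `‖Qᵢ‖ ≤ M_Q`, `‖Q¹ − Q⁰‖ ≤ δ_Q`, `‖R¹D*¹w − R⁰D*⁰w‖ ≤ δ_P N(w)`,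
  `‖R⁰D*⁰w‖ ≤ M_P N(w)`, `‖P(G¹(D¹(R¹t)))‖ ≤ a₁‖t‖`, `‖P(G¹(D⁰r))‖ ≤ χ‖r‖`, `‖D¹ − D⁰‖ ≤ δ_D`, `‖R¹ − R⁰‖ ≤ δ_R`, `‖R¹‖ ≤ M_R`, `N(G⁰(D⁰(R⁰t))) ≤ w₀‖t‖`.
* §2 (the `B11Eq103H1Complex` letters) **`weight_G1K_adj_le`** — `N(G₁(P′v)) ≤ √(c_P∕γ)‖v‖` for an adjoint pair `(P, P′)` with `‖Px‖² ≤ c_P·re⟨x, Δ_ax⟩` and a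
  strong coercivity `γN(z)² ≤ re⟨z, Δ_az⟩` (the weight version of `B9Eq3153FrakGVariational.norm_G1K_adj_le`).
* §3 **`norm_apply_frakG_sub_le`** — §1 DISCHARGED for two structures `Tᵢ = laplaceAK Δᵢ Dᵢ Rᵢ D*ᵢ Qᵢ Qᵢ† a` (`Gᵢ = G1K`, `Hᵢ = H1K`): `ε_G = Θ∕γ`
  (`B9Eq386GreenLipschitzEnergy`), `g₀ = γ₀⁻¹`, `g₁ = γ⁻¹`, `L_H` = `B9Eq3126H1LipschitzEnergy.norm_apply_H1K_sub_le`'s constant, `h₀ = √(C₀∕γ₀)`,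
  `a₁ = √(c_R¹∕γ)`, `χ = γ⁻¹` (the cross pair `(D*⁰, D⁰)`: the FLAT divergence is a row of the weight), `w₀ = √(c_R⁰∕γ₀)` — every letter a form letter.
MODEL ∕ HONEST SCOPE.  (M1) finite-dimensional `𝕜`-Hilbert `E`, `F`; `S`, `V` inner-product spaces.  (M2) displayed letters only (listed above).  (M3) FIRST order at two
structures (e.g. `U` vs the flat point); crude constants; no analyticity, no kernel bound, no decay, no volume.  The k-level instance on the diagonal (the tower's
`frakGLatticeK`, `∃ α₀ C` before every binder, modulo `C_R` and the `K⁻¹`-letters) is the successor's file.  NOT summit progress (cell pub-balaban: NE9 NOT PRINTED ∕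
NOT PROVED; «NE9 ⇐ the named binders»; row WALLED ON A MODEL (O-NE9-1; #5 UNRULED); spine PROVED 0∕9; rung (B)+1 finite T⁴ — NOT infinite volume, NOT mass gap,
NOT BetaPertH, NOT Clay).  HONEST DEPENDENCY (cell line): continuum YM on T⁴ ⇐ BetaPertH ∧ nine spine estimates (0/9 proved); BetaPertH ⇐ (D1) ∧ (D4) ∧ CAP+tail;
G-an2-4 gates asym, D1 and NE2/3/4.  NEW file importing the owner's `B9Eq3153FrakGVariational`, `B9Eq386GreenLipschitzEnergy`, `B9Eq3126H1LipschitzEnergy` only;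
nothing modified.  Net new unproved facts: 0.
-/

noncomputable section

open scoped InnerProductSpace ComplexConjugate BigOperators

namespace Literature.MathematicalPhysics.QuantumFieldTheory.Balaban1983to89.B9Eq3153FrakGLipschitzEnergy

open B11Eq103H1Complex (laplaceAK G1K KinvK H1K)

/-! ## §1 The assembly: `𝔊¹ − 𝔊⁰` from its seven pieces (plain normed spaces) -/

section Pieces

variable {𝕜 : Type*} [RCLike 𝕜] {E : Type*} [NormedAddCommGroup E] [InnerProductSpace 𝕜 E] {F : Type*} [NormedAddCommGroup F] [InnerProductSpace 𝕜 F]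
  {S : Type*} [NormedAddCommGroup S] [InnerProductSpace 𝕜 S] {V : Type*} [NormedAddCommGroup V] [InnerProductSpace 𝕜 V]
  (G₀ G₁ : E →ₗ[𝕜] E) (H₀ H₁ : F →ₗ[𝕜] E) (Q₀ Q₁ : E →ₗ[𝕜] F) (D₀ D₁ : S →ₗ[𝕜] E) (R₀ R₁ : S →ₗ[𝕜] S) (Ds₀ Ds₁ : E →ₗ[𝕜] S)
  (P : E →ₗ[𝕜] V) (N : E → ℝ) (hNn : ∀ w, ‖w‖ ≤ N w) (hPN : ∀ w, ‖P w‖ ≤ N w)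
  {εG g₀ g₁ LH h₀ MQ δQ δP MP a₁ χ δD δR MR w₀ : ℝ}
  (hεG : 0 ≤ εG) (hg₁ : 0 ≤ g₁) (hLH : 0 ≤ LH) (hh₀ : 0 ≤ h₀) (hMQ : 0 ≤ MQ) (hδQ : 0 ≤ δQ) (hδP : 0 ≤ δP) (hMP : 0 ≤ MP)
  (ha₁ : 0 ≤ a₁) (hχ : 0 ≤ χ) (hδD : 0 ≤ δD) (hδR : 0 ≤ δR) (hMR : 0 ≤ MR) (hw₀ : 0 ≤ w₀)
  (hGd : ∀ y, N (G₀ y - G₁ y) ≤ εG * N (G₀ y)) (hG0 : ∀ y, N (G₀ y) ≤ g₀ * ‖y‖) (hG1 : ∀ y, N (G₁ y) ≤ g₁ * ‖y‖)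
  (hHd : ∀ b, ‖P (H₁ b - H₀ b)‖ ≤ LH * ‖b‖) (hH0 : ∀ c, N (H₀ c) ≤ h₀ * ‖c‖)
  (hQ1 : ∀ w, ‖Q₁ w‖ ≤ MQ * ‖w‖) (hQ0 : ∀ w, ‖Q₀ w‖ ≤ MQ * ‖w‖) (hQd : ∀ w, ‖Q₁ w - Q₀ w‖ ≤ δQ * ‖w‖)
  (hPd : ∀ w, ‖R₁ (Ds₁ w) - R₀ (Ds₀ w)‖ ≤ δP * N w) (hP0 : ∀ w, ‖R₀ (Ds₀ w)‖ ≤ MP * N w)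
  (hA1 : ∀ t, ‖P (G₁ (D₁ (R₁ t)))‖ ≤ a₁ * ‖t‖) (hX : ∀ r, ‖P (G₁ (D₀ r))‖ ≤ χ * ‖r‖)
  (hDd : ∀ s, ‖D₁ s - D₀ s‖ ≤ δD * ‖s‖) (hRd : ∀ t, ‖R₁ t - R₀ t‖ ≤ δR * ‖t‖) (hR1 : ∀ t, ‖R₁ t‖ ≤ MR * ‖t‖)
  (hW0 : ∀ t, N (G₀ (D₀ (R₀ t))) ≤ w₀ * ‖t‖) (hRR₀ : ∀ t, R₀ (R₀ t) = R₀ t) (hRR₁ : ∀ t, R₁ (R₁ t) = R₁ t)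

include hNn hεG hGd hG0 in
/-- `‖G¹x − G⁰x‖ ≤ ε_G g₀‖x‖` (the first piece in the plain norm). [folklore] [cite: Balaban1985BackgroundPropagators, Thm 3.4 p.400] -/
theorem norm_G_sub_le (x : E) : ‖G₁ x - G₀ x‖ ≤ εG * g₀ * ‖x‖ := by
  rw [← norm_neg, neg_sub]
  calc ‖G₀ x - G₁ x‖ ≤ N (G₀ x - G₁ x) := hNn _
    _ ≤ εG * N (G₀ x) := hGd x
    _ ≤ εG * (g₀ * ‖x‖) := mul_le_mul_of_nonneg_left (hG0 x) hεG
    _ = εG * g₀ * ‖x‖ := by ring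

include hPN hεG hGd hG0 in
/-- `‖P(G¹x − G⁰x)‖ ≤ ε_G g₀‖x‖` (the first piece, rows). [folklore] [cite: Balaban1985BackgroundPropagators, Thm 3.4 p.400] -/
theorem norm_apply_G_sub_le (x : E) : ‖P (G₁ x - G₀ x)‖ ≤ εG * g₀ * ‖x‖ := by
  rw [← norm_neg, ← map_neg, neg_sub]
  calc ‖P (G₀ x - G₁ x)‖ ≤ N (G₀ x - G₁ x) := hPN _
    _ ≤ εG * N (G₀ x) := hGd x
    _ ≤ εG * (g₀ * ‖x‖) := mul_le_mul_of_nonneg_left (hG0 x) hεG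
    _ = εG * g₀ * ‖x‖ := by ring

include hNn hPN hεG hLH hh₀ hMQ hδQ hGd hG0 hG1 hHd hH0 hQ1 hQ0 hQd in
/-- **THE SECOND PIECE**: `‖P(H¹(Q¹(G¹x)) − H⁰(Q⁰(G⁰x)))‖ ≤ (L_H M_Q g₁ + h₀(δ_Q g₁ + M_Q ε_G g₀))‖x‖` — `H¹b − H⁰b` on `b = Q¹G¹x` plus `H⁰(b − b₀)` with
`‖b − b₀‖ ≤ δ_Q‖G¹x‖ + M_Q‖G¹x − G⁰x‖`. [folklore] [cite: Balaban1985BackgroundPropagators, (3.153) p.426, (3.126) p.420, Thm 3.4 p.400] -/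
theorem norm_apply_HQG_sub_le (x : E) :
    ‖P (H₁ (Q₁ (G₁ x)) - H₀ (Q₀ (G₀ x)))‖ ≤ (LH * MQ * g₁ + h₀ * (δQ * g₁ + MQ * εG * g₀)) * ‖x‖ := by
  have hG1x : ‖G₁ x‖ ≤ g₁ * ‖x‖ := (hNn _).trans (hG1 x)
  have hb : ‖Q₁ (G₁ x)‖ ≤ MQ * g₁ * ‖x‖ := by
    calc ‖Q₁ (G₁ x)‖ ≤ MQ * ‖G₁ x‖ := hQ1 _
      _ ≤ MQ * (g₁ * ‖x‖) := mul_le_mul_of_nonneg_left hG1x hMQ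
      _ = MQ * g₁ * ‖x‖ := by ring
  have hbb : ‖Q₁ (G₁ x) - Q₀ (G₀ x)‖ ≤ (δQ * g₁ + MQ * εG * g₀) * ‖x‖ := by
    have hs : Q₁ (G₁ x) - Q₀ (G₀ x) = (Q₁ (G₁ x) - Q₀ (G₁ x)) + Q₀ (G₁ x - G₀ x) := by rw [map_sub]; abel
    rw [hs]
    calc ‖(Q₁ (G₁ x) - Q₀ (G₁ x)) + Q₀ (G₁ x - G₀ x)‖ ≤ ‖Q₁ (G₁ x) - Q₀ (G₁ x)‖ + ‖Q₀ (G₁ x - G₀ x)‖ := norm_add_le _ _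
      _ ≤ δQ * ‖G₁ x‖ + MQ * ‖G₁ x - G₀ x‖ := add_le_add (hQd _) (hQ0 _)
      _ ≤ δQ * (g₁ * ‖x‖) + MQ * (εG * g₀ * ‖x‖) :=
          add_le_add (mul_le_mul_of_nonneg_left hG1x hδQ) (mul_le_mul_of_nonneg_left (norm_G_sub_le G₀ G₁ N hNn hεG hGd hG0 x) hMQ)
      _ = (δQ * g₁ + MQ * εG * g₀) * ‖x‖ := by ring
  have hs : H₁ (Q₁ (G₁ x)) - H₀ (Q₀ (G₀ x)) = (H₁ (Q₁ (G₁ x)) - H₀ (Q₁ (G₁ x))) + H₀ (Q₁ (G₁ x) - Q₀ (G₀ x)) := by rw [map_sub]; abel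
  rw [hs, map_add]
  calc ‖P (H₁ (Q₁ (G₁ x)) - H₀ (Q₁ (G₁ x))) + P (H₀ (Q₁ (G₁ x) - Q₀ (G₀ x)))‖
      ≤ ‖P (H₁ (Q₁ (G₁ x)) - H₀ (Q₁ (G₁ x)))‖ + ‖P (H₀ (Q₁ (G₁ x) - Q₀ (G₀ x)))‖ := norm_add_le _ _
    _ ≤ LH * ‖Q₁ (G₁ x)‖ + N (H₀ (Q₁ (G₁ x) - Q₀ (G₀ x))) := add_le_add (hHd _) (hPN _)
    _ ≤ LH * (MQ * g₁ * ‖x‖) + h₀ * ‖Q₁ (G₁ x) - Q₀ (G₀ x)‖ := add_le_add (mul_le_mul_of_nonneg_left hb hLH) (hH0 _)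
    _ ≤ LH * (MQ * g₁ * ‖x‖) + h₀ * ((δQ * g₁ + MQ * εG * g₀) * ‖x‖) := by
        have := mul_le_mul_of_nonneg_left hbb hh₀; linarith only [this]
    _ = (LH * MQ * g₁ + h₀ * (δQ * g₁ + MQ * εG * g₀)) * ‖x‖ := by ring

include hPN hεG hg₁ hδP hMP ha₁ hχ hδD hδR hMR hw₀ hGd hG0 hG1 hPd hP0 hA1 hX hDd hRd hR1 hW0 hRR₀ hRR₁ in
/-- **THE THIRD PIECE**: `‖P(G¹D¹R¹D*¹G¹x − G⁰D⁰R⁰D*⁰G⁰x)‖ ≤ (a₁(δ_P g₁ + M_P ε_G g₀) + (g₁δ_D M_R + χδ_R + ε_G w₀)M_P g₀)‖x‖` — with `sᵢ = RᵢD*ᵢGᵢx`: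
`G¹D¹R¹(s₁ − s₀)` (the sandwich `a₁`), `G¹((D¹ − D⁰)(R¹s₀))`, `G¹(D⁰((R¹ − R⁰)s₀))` (the cross sandwich `χ`), `(G¹ − G⁰)(D⁰R⁰s₀)` (`ε_G w₀`). [folklore]
[cite: Balaban1985BackgroundPropagators, (3.153) p.426, Thm 3.11 p.416, Thm 3.4 p.400] -/
theorem norm_apply_GDRDG_sub_le (x : E) :
    ‖P (G₁ (D₁ (R₁ (Ds₁ (G₁ x)))) - G₀ (D₀ (R₀ (Ds₀ (G₀ x)))))‖ ≤
      (a₁ * (δP * g₁ + MP * εG * g₀) + (g₁ * δD * MR + χ * δR + εG * w₀) * MP * g₀) * ‖x‖ := by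
  -- the two block data `sᵢ = Rᵢ(D*ᵢ(Gᵢx))`
  have hs₀ : ‖R₀ (Ds₀ (G₀ x))‖ ≤ MP * g₀ * ‖x‖ := by
    calc ‖R₀ (Ds₀ (G₀ x))‖ ≤ MP * N (G₀ x) := hP0 _
      _ ≤ MP * (g₀ * ‖x‖) := mul_le_mul_of_nonneg_left (hG0 x) hMP
      _ = MP * g₀ * ‖x‖ := by ring
  have hsd : ‖R₁ (Ds₁ (G₁ x)) - R₀ (Ds₀ (G₀ x))‖ ≤ (δP * g₁ + MP * εG * g₀) * ‖x‖ := by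
    have hs : R₁ (Ds₁ (G₁ x)) - R₀ (Ds₀ (G₀ x)) = (R₁ (Ds₁ (G₁ x)) - R₀ (Ds₀ (G₁ x))) - R₀ (Ds₀ (G₀ x - G₁ x)) := by
      rw [map_sub, map_sub]; abel
    rw [hs]
    calc ‖(R₁ (Ds₁ (G₁ x)) - R₀ (Ds₀ (G₁ x))) - R₀ (Ds₀ (G₀ x - G₁ x))‖
        ≤ ‖R₁ (Ds₁ (G₁ x)) - R₀ (Ds₀ (G₁ x))‖ + ‖R₀ (Ds₀ (G₀ x - G₁ x))‖ := norm_sub_le _ _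
      _ ≤ δP * N (G₁ x) + MP * N (G₀ x - G₁ x) := add_le_add (hPd _) (hP0 _)
      _ ≤ δP * (g₁ * ‖x‖) + MP * (εG * N (G₀ x)) := add_le_add (mul_le_mul_of_nonneg_left (hG1 x) hδP) (mul_le_mul_of_nonneg_left (hGd x) hMP)
      _ ≤ δP * (g₁ * ‖x‖) + MP * (εG * (g₀ * ‖x‖)) := by
          have := mul_le_mul_of_nonneg_left (mul_le_mul_of_nonneg_left (hG0 x) hεG) hMP; linarith only [this]
      _ = (δP * g₁ + MP * εG * g₀) * ‖x‖ := by ring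
  -- (1) `G¹D¹R¹(s₁ − s₀)`
  have h1 : ‖P (G₁ (D₁ (R₁ (R₁ (Ds₁ (G₁ x)) - R₀ (Ds₀ (G₀ x))))))‖ ≤ a₁ * (δP * g₁ + MP * εG * g₀) * ‖x‖ := by
    calc ‖P (G₁ (D₁ (R₁ (R₁ (Ds₁ (G₁ x)) - R₀ (Ds₀ (G₀ x))))))‖ ≤ a₁ * ‖R₁ (Ds₁ (G₁ x)) - R₀ (Ds₀ (G₀ x))‖ := hA1 _
      _ ≤ a₁ * ((δP * g₁ + MP * εG * g₀) * ‖x‖) := mul_le_mul_of_nonneg_left hsd ha₁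
      _ = a₁ * (δP * g₁ + MP * εG * g₀) * ‖x‖ := by ring
  -- (2) `G¹((D¹ − D⁰)(R¹s₀))`
  have h2 : ‖P (G₁ (D₁ (R₁ (R₀ (Ds₀ (G₀ x)))) - D₀ (R₁ (R₀ (Ds₀ (G₀ x))))))‖ ≤ g₁ * δD * MR * (MP * g₀) * ‖x‖ := by
    calc ‖P (G₁ (D₁ (R₁ (R₀ (Ds₀ (G₀ x)))) - D₀ (R₁ (R₀ (Ds₀ (G₀ x))))))‖ ≤ N (G₁ (D₁ (R₁ (R₀ (Ds₀ (G₀ x)))) - D₀ (R₁ (R₀ (Ds₀ (G₀ x)))))) := hPN _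
      _ ≤ g₁ * ‖D₁ (R₁ (R₀ (Ds₀ (G₀ x)))) - D₀ (R₁ (R₀ (Ds₀ (G₀ x))))‖ := hG1 _
      _ ≤ g₁ * (δD * ‖R₁ (R₀ (Ds₀ (G₀ x)))‖) := mul_le_mul_of_nonneg_left (hDd _) hg₁
      _ ≤ g₁ * (δD * (MR * ‖R₀ (Ds₀ (G₀ x))‖)) := mul_le_mul_of_nonneg_left (mul_le_mul_of_nonneg_left (hR1 _) hδD) hg₁
      _ ≤ g₁ * (δD * (MR * (MP * g₀ * ‖x‖))) :=
          mul_le_mul_of_nonneg_left (mul_le_mul_of_nonneg_left (mul_le_mul_of_nonneg_left hs₀ hMR) hδD) hg₁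
      _ = g₁ * δD * MR * (MP * g₀) * ‖x‖ := by ring
  -- (3) `G¹(D⁰((R¹ − R⁰)s₀))`
  have h3 : ‖P (G₁ (D₀ (R₁ (R₀ (Ds₀ (G₀ x))) - R₀ (R₀ (Ds₀ (G₀ x))))))‖ ≤ χ * δR * (MP * g₀) * ‖x‖ := by
    calc ‖P (G₁ (D₀ (R₁ (R₀ (Ds₀ (G₀ x))) - R₀ (R₀ (Ds₀ (G₀ x))))))‖ ≤ χ * ‖R₁ (R₀ (Ds₀ (G₀ x))) - R₀ (R₀ (Ds₀ (G₀ x)))‖ := hX _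
      _ ≤ χ * (δR * ‖R₀ (Ds₀ (G₀ x))‖) := mul_le_mul_of_nonneg_left (hRd _) hχ
      _ ≤ χ * (δR * (MP * g₀ * ‖x‖)) := mul_le_mul_of_nonneg_left (mul_le_mul_of_nonneg_left hs₀ hδR) hχ
      _ = χ * δR * (MP * g₀) * ‖x‖ := by ring
  -- (4) `(G¹ − G⁰)(D⁰R⁰s₀)`
  have h4 : ‖P (G₁ (D₀ (R₀ (R₀ (Ds₀ (G₀ x))))) - G₀ (D₀ (R₀ (R₀ (Ds₀ (G₀ x))))))‖ ≤ εG * w₀ * (MP * g₀) * ‖x‖ := by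
    rw [← norm_neg, ← map_neg, neg_sub]
    calc ‖P (G₀ (D₀ (R₀ (R₀ (Ds₀ (G₀ x))))) - G₁ (D₀ (R₀ (R₀ (Ds₀ (G₀ x))))))‖
        ≤ N (G₀ (D₀ (R₀ (R₀ (Ds₀ (G₀ x))))) - G₁ (D₀ (R₀ (R₀ (Ds₀ (G₀ x)))))) := hPN _
      _ ≤ εG * N (G₀ (D₀ (R₀ (R₀ (Ds₀ (G₀ x)))))) := hGd _
      _ ≤ εG * (w₀ * ‖R₀ (Ds₀ (G₀ x))‖) := mul_le_mul_of_nonneg_left (hW0 _) hεG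
      _ ≤ εG * (w₀ * (MP * g₀ * ‖x‖)) := mul_le_mul_of_nonneg_left (mul_le_mul_of_nonneg_left hs₀ hw₀) hεG
      _ = εG * w₀ * (MP * g₀) * ‖x‖ := by ring
  have hdec : G₁ (D₁ (R₁ (Ds₁ (G₁ x)))) - G₀ (D₀ (R₀ (Ds₀ (G₀ x)))) =
      G₁ (D₁ (R₁ (R₁ (Ds₁ (G₁ x)) - R₀ (Ds₀ (G₀ x))))) + G₁ (D₁ (R₁ (R₀ (Ds₀ (G₀ x)))) - D₀ (R₁ (R₀ (Ds₀ (G₀ x))))) +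
        G₁ (D₀ (R₁ (R₀ (Ds₀ (G₀ x))) - R₀ (R₀ (Ds₀ (G₀ x))))) + (G₁ (D₀ (R₀ (R₀ (Ds₀ (G₀ x))))) - G₀ (D₀ (R₀ (R₀ (Ds₀ (G₀ x)))))) := by
    simp only [map_sub, hRR₀, hRR₁]; abel
  rw [hdec, map_add, map_add, map_add]
  refine (norm_add_le_of_le (norm_add_le_of_le (norm_add_le_of_le h1 h2) h3) h4).trans (le_of_eq ?_)
  ring

include hNn hPN hεG hg₁ hLH hh₀ hMQ hδQ hδP hMP ha₁ hχ hδD hδR hMR hw₀ hGd hG0 hG1 hHd hH0 hQ1 hQ0 hQd hPd hP0 hA1 hX hDd hRd hR1 hW0 hRR₀ hRR₁ in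
/-- **`𝔊` IS LIPSCHITZ IN THE DATA, ROW BY ROW, FROM ITS SEVEN PIECES**: with `𝔊ᵢx = Gᵢx − Hᵢ(Qᵢ(Gᵢx)) − Gᵢ(Dᵢ(Rᵢ(D*ᵢ(Gᵢx))))` ((3.153) read with
`H₁ = G₁Q†(QG₁Q†)⁻¹`), `‖P(𝔊¹x − 𝔊⁰x)‖ ≤ (ε_G g₀ + (L_H M_Q g₁ + h₀(δ_Q g₁ + M_Q ε_G g₀)) + (a₁(δ_P g₁ + M_P ε_G g₀) + (g₁δ_D M_R + χδ_R + ε_G w₀)M_P g₀))·‖x‖`.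
Pure normed-space algebra over the displayed piece letters; §3 discharges every letter by a form letter. [folklore]
[cite: Balaban1985BackgroundPropagators, (3.153) p.426, Thm 3.13 p.426, Thm 3.4 p.400] -/
theorem norm_apply_frakG_sub_le_of_pieces (x : E) :
    ‖P ((G₁ x - H₁ (Q₁ (G₁ x)) - G₁ (D₁ (R₁ (Ds₁ (G₁ x))))) - (G₀ x - H₀ (Q₀ (G₀ x)) - G₀ (D₀ (R₀ (Ds₀ (G₀ x))))))‖ ≤
      (εG * g₀ + (LH * MQ * g₁ + h₀ * (δQ * g₁ + MQ * εG * g₀)) +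
        (a₁ * (δP * g₁ + MP * εG * g₀) + (g₁ * δD * MR + χ * δR + εG * w₀) * MP * g₀)) * ‖x‖ := by
  have hs : (G₁ x - H₁ (Q₁ (G₁ x)) - G₁ (D₁ (R₁ (Ds₁ (G₁ x))))) - (G₀ x - H₀ (Q₀ (G₀ x)) - G₀ (D₀ (R₀ (Ds₀ (G₀ x))))) =
      (G₁ x - G₀ x) - (H₁ (Q₁ (G₁ x)) - H₀ (Q₀ (G₀ x))) - (G₁ (D₁ (R₁ (Ds₁ (G₁ x)))) - G₀ (D₀ (R₀ (Ds₀ (G₀ x))))) := by abel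
  rw [hs, map_sub, map_sub, add_mul, add_mul]
  exact norm_sub_le_of_le (norm_sub_le_of_le (norm_apply_G_sub_le G₀ G₁ P N hPN hεG hGd hG0 x)
    (norm_apply_HQG_sub_le G₀ G₁ H₀ H₁ Q₀ Q₁ P N hNn hPN hεG hLH hh₀ hMQ hδQ hGd hG0 hG1 hHd hH0 hQ1 hQ0 hQd x))
    (norm_apply_GDRDG_sub_le G₀ G₁ D₀ D₁ R₀ R₁ Ds₀ Ds₁ P N hPN hεG hg₁ hδP hMP ha₁ hχ hδD hδR hMR hw₀ hGd hG0 hG1 hPd hP0 hA1 hX hDd hRd hR1 hW0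
      hRR₀ hRR₁ x)

end Pieces

/-! ## §2 The weight of `G₁(P′v)` for an adjoint pair dominated by the energy -/

section Weight

open B9Eq3153FrakGVariational (re_inner_G1K_laplaceAK_G1K re_inner_G1K_adj_le)

variable {𝕜 : Type*} [RCLike 𝕜] {E : Type*} [NormedAddCommGroup E] [InnerProductSpace 𝕜 E] [FiniteDimensional 𝕜 E]
  {F : Type*} [NormedAddCommGroup F] [InnerProductSpace 𝕜 F] [FiniteDimensional 𝕜 F] {S : Type*} [NormedAddCommGroup S] [InnerProductSpace 𝕜 S]
  {V : Type*} [NormedAddCommGroup V] [InnerProductSpace 𝕜 V]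
  {Δ : E →ₗ[𝕜] E} {D : S →ₗ[𝕜] E} {R : S →ₗ[𝕜] S} {Dstar : E →ₗ[𝕜] S} {Q : E →ₗ[𝕜] F} {a : 𝕜}
  (hpos : ∀ x : E, x ≠ 0 → 0 < RCLike.re ⟪x, laplaceAK Δ D R Dstar Q (LinearMap.adjoint Q) a x⟫_𝕜)

/-- **`N(G₁(P′v)) ≤ √(c_P∕γ)·‖v‖`** in a weight `N` with the strong coercivity `γN(z)² ≤ re⟨z, Δ_az⟩`, for an adjoint pair `(P, P′)` with `‖Px‖² ≤ c_P·re⟨x, Δ_ax⟩`: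
`γN(G₁u)² ≤ re⟨G₁u, u⟩ ≤ c_P‖v‖²` (`B9Eq3153FrakGVariational.re_inner_G1K_adj_le`).  E.g. `N(G₁DR·t) ≤ √(c_R∕γ)‖t‖` — no operator bound of `D`. [folklore]
[cite: Balaban1985BackgroundPropagators, Thm 3.11 p.416, (3.153) p.426] -/
theorem weight_G1K_adj_le (N : E → ℝ) (hN : ∀ w, 0 ≤ N w) {γ : ℝ} (hγ : 0 < γ)
    (hcoerN : ∀ z : E, γ * N z ^ 2 ≤ RCLike.re ⟪z, laplaceAK Δ D R Dstar Q (LinearMap.adjoint Q) a z⟫_𝕜)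
    (P : E →ₗ[𝕜] V) {cP : ℝ} (hcP : 0 ≤ cP) (hP : ∀ x : E, ‖P x‖ ^ 2 ≤ cP * RCLike.re ⟪x, laplaceAK Δ D R Dstar Q (LinearMap.adjoint Q) a x⟫_𝕜)
    (P' : V →ₗ[𝕜] E) (hPP' : ∀ (x : E) (v : V), ⟪P x, v⟫_𝕜 = ⟪x, P' v⟫_𝕜) (v : V) :
    N (G1K Δ D R Dstar Q (LinearMap.adjoint Q) a hpos (P' v)) ≤ Real.sqrt (cP / γ) * ‖v‖ := by
  have h1 : γ * N (G1K Δ D R Dstar Q (LinearMap.adjoint Q) a hpos (P' v)) ^ 2 ≤ cP * ‖v‖ ^ 2 := by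
    calc γ * N (G1K Δ D R Dstar Q (LinearMap.adjoint Q) a hpos (P' v)) ^ 2
        ≤ RCLike.re ⟪G1K Δ D R Dstar Q (LinearMap.adjoint Q) a hpos (P' v),
            laplaceAK Δ D R Dstar Q (LinearMap.adjoint Q) a (G1K Δ D R Dstar Q (LinearMap.adjoint Q) a hpos (P' v))⟫_𝕜 := hcoerN _
      _ = RCLike.re ⟪G1K Δ D R Dstar Q (LinearMap.adjoint Q) a hpos (P' v), P' v⟫_𝕜 := re_inner_G1K_laplaceAK_G1K hpos _
      _ ≤ cP * ‖v‖ ^ 2 := re_inner_G1K_adj_le hpos P hcP hP P' hPP' v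
  have h2 : N (G1K Δ D R Dstar Q (LinearMap.adjoint Q) a hpos (P' v)) ^ 2 ≤ cP / γ * ‖v‖ ^ 2 := by
    rw [div_mul_eq_mul_div, le_div_iff₀ hγ, mul_comm]; exact h1
  calc N (G1K Δ D R Dstar Q (LinearMap.adjoint Q) a hpos (P' v)) = Real.sqrt (N (G1K Δ D R Dstar Q (LinearMap.adjoint Q) a hpos (P' v)) ^ 2) :=
        (Real.sqrt_sq (hN _)).symm
    _ ≤ Real.sqrt (cP / γ * ‖v‖ ^ 2) := Real.sqrt_le_sqrt h2
    _ = Real.sqrt (cP / γ) * ‖v‖ := by rw [Real.sqrt_mul (div_nonneg hcP hγ.le), Real.sqrt_sq (norm_nonneg _)]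

end Weight

/-! ## §3 The discharge: two structures `Tᵢ = laplaceAK Δᵢ Dᵢ Rᵢ D*ᵢ Qᵢ Qᵢ† a`, every piece letter a form letter -/

section Discharge

open B11Eq111FrakG (frakGLin)
open B9Eq3153FrakGVariational (frakGLin_apply_H1K norm_apply_G1K_adj_le')
open B9Eq386GreenLipschitzEnergy (weight_green_le weight_green_sub_le)
open B9Eq3126H1LipschitzEnergy (weight_H1K_le norm_apply_H1K_sub_le)

variable {𝕜 : Type*} [RCLike 𝕜] {E : Type*} [NormedAddCommGroup E] [InnerProductSpace 𝕜 E] [FiniteDimensional 𝕜 E]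
  {F : Type*} [NormedAddCommGroup F] [InnerProductSpace 𝕜 F] [FiniteDimensional 𝕜 F] {S : Type*} [NormedAddCommGroup S] [InnerProductSpace 𝕜 S]
  {V : Type*} [NormedAddCommGroup V] [InnerProductSpace 𝕜 V]
  {Δ₀ Δ₁ : E →ₗ[𝕜] E} {D₀ D₁ : S →ₗ[𝕜] E} {R₀ R₁ : S →ₗ[𝕜] S} {Dstar₀ Dstar₁ : E →ₗ[𝕜] S} {Q₀ Q₁ : E →ₗ[𝕜] F} {a : 𝕜}
  (hpos₀ : ∀ x : E, x ≠ 0 → 0 < RCLike.re ⟪x, laplaceAK Δ₀ D₀ R₀ Dstar₀ Q₀ (LinearMap.adjoint Q₀) a x⟫_𝕜)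
  (hadj₀ : ∀ (x : E) (y : F), ⟪Q₀ x, y⟫_𝕜 = ⟪x, LinearMap.adjoint Q₀ y⟫_𝕜) (hinj₀ : Function.Injective (LinearMap.adjoint Q₀))
  (hpos₁ : ∀ x : E, x ≠ 0 → 0 < RCLike.re ⟪x, laplaceAK Δ₁ D₁ R₁ Dstar₁ Q₁ (LinearMap.adjoint Q₁) a x⟫_𝕜)
  (hadj₁ : ∀ (x : E) (y : F), ⟪Q₁ x, y⟫_𝕜 = ⟪x, LinearMap.adjoint Q₁ y⟫_𝕜) (hinj₁ : Function.Injective (LinearMap.adjoint Q₁))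
  (N : E → ℝ) (hN : ∀ w, 0 ≤ N w) (hNn : ∀ w, ‖w‖ ≤ N w) {γ γ₀ Θ δQ C₀ C₁ MQ δP MP cR₀ cR₁ δD δR MR : ℝ} (hγ : 0 < γ) (hγ₀ : 0 < γ₀) (hΘ : 0 ≤ Θ)
  (hδQ : 0 ≤ δQ) (hC₀ : 0 ≤ C₀) (hC₁ : 0 ≤ C₁) (hMQ : 0 ≤ MQ) (hδP : 0 ≤ δP) (hMP : 0 ≤ MP) (hcR₀ : 0 ≤ cR₀) (hcR₁ : 0 ≤ cR₁) (hδD : 0 ≤ δD)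
  (hδR : 0 ≤ δR) (hMR : 0 ≤ MR)
  (hcoer₁ : ∀ z : E, γ * N z ^ 2 ≤ RCLike.re ⟪z, laplaceAK Δ₁ D₁ R₁ Dstar₁ Q₁ (LinearMap.adjoint Q₁) a z⟫_𝕜)
  (hcoer₀ : ∀ z : E, γ₀ * N z ^ 2 ≤ RCLike.re ⟪z, laplaceAK Δ₀ D₀ R₀ Dstar₀ Q₀ (LinearMap.adjoint Q₀) a z⟫_𝕜)
  (hT : ∀ u v : E, ‖⟪u, laplaceAK Δ₁ D₁ R₁ Dstar₁ Q₁ (LinearMap.adjoint Q₁) a v⟫_𝕜 - ⟪u, laplaceAK Δ₀ D₀ R₀ Dstar₀ Q₀ (LinearMap.adjoint Q₀) a v⟫_𝕜‖ ≤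
    Θ * N u * N v)
  (hQd : ∀ w : E, ‖Q₁ w - Q₀ w‖ ≤ δQ * ‖w‖)
  (hK₀ : ∀ b : F, ‖KinvK hpos₀ hadj₀ hinj₀ b‖ ≤ C₀ * ‖b‖) (hK₁ : ∀ c : F, ‖KinvK hpos₁ hadj₁ hinj₁ c‖ ≤ C₁ * ‖c‖)
  (hQ1 : ∀ w : E, ‖Q₁ w‖ ≤ MQ * ‖w‖) (hQ0 : ∀ w : E, ‖Q₀ w‖ ≤ MQ * ‖w‖)
  (hPd : ∀ w : E, ‖R₁ (Dstar₁ w) - R₀ (Dstar₀ w)‖ ≤ δP * N w) (hP0 : ∀ w : E, ‖R₀ (Dstar₀ w)‖ ≤ MP * N w)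
  (hRD₁ : ∀ x : E, ‖R₁ (Dstar₁ x)‖ ^ 2 ≤ cR₁ * RCLike.re ⟪x, laplaceAK Δ₁ D₁ R₁ Dstar₁ Q₁ (LinearMap.adjoint Q₁) a x⟫_𝕜)
  (hRD₀ : ∀ x : E, ‖R₀ (Dstar₀ x)‖ ^ 2 ≤ cR₀ * RCLike.re ⟪x, laplaceAK Δ₀ D₀ R₀ Dstar₀ Q₀ (LinearMap.adjoint Q₀) a x⟫_𝕜)
  (hDD₀ : ∀ (s : S) (x : E), ⟪D₀ s, x⟫_𝕜 = ⟪s, Dstar₀ x⟫_𝕜) (hDD₁ : ∀ (s : S) (x : E), ⟪D₁ s, x⟫_𝕜 = ⟪s, Dstar₁ x⟫_𝕜)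
  (hRsym₀ : ∀ s t : S, ⟪R₀ s, t⟫_𝕜 = ⟪s, R₀ t⟫_𝕜) (hRsym₁ : ∀ s t : S, ⟪R₁ s, t⟫_𝕜 = ⟪s, R₁ t⟫_𝕜) (hRR₀ : ∀ s : S, R₀ (R₀ s) = R₀ s)
  (hRR₁ : ∀ s : S, R₁ (R₁ s) = R₁ s) (hDs₀ : ∀ w : E, ‖Dstar₀ w‖ ≤ N w)
  (hDd : ∀ s : S, ‖D₁ s - D₀ s‖ ≤ δD * ‖s‖) (hRd : ∀ t : S, ‖R₁ t - R₀ t‖ ≤ δR * ‖t‖) (hR1 : ∀ t : S, ‖R₁ t‖ ≤ MR * ‖t‖)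

include hN hNn hγ hγ₀ hΘ hδQ hC₀ hC₁ hMQ hδP hMP hcR₀ hcR₁ hδD hδR hMR hcoer₁ hcoer₀ hT hQd hK₀ hK₁ hQ1 hQ0 hPd hP0 hRD₁ hRD₀ hDD₀ hDD₁ hRsym₀ hRsym₁ hRR₀ hRR₁ hDs₀
  hDd hRd hR1 in
/-- **THE THIRD GREEN'S LETTER IS LIPSCHITZ IN THE DATA IN THE ENERGY NORM, FROM FORM LETTERS ALONE**: for every `P` dominated by the weight (`‖Pw‖ ≤ N(w)`),
`‖P(𝔊¹x − 𝔊⁰x)‖ ≤ C·‖x‖` with `C` the constant of §1 at `ε_G = Θ∕γ`, `g₀ = γ₀⁻¹`, `g₁ = γ⁻¹`, `L_H = (Θ√(C₀∕γ₀) + δ_QC₀)∕γ + √(C₁∕γ)δ_Q√(C₀∕γ₀)`,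
`h₀ = √(C₀∕γ₀)`, `a₁ = √(γ⁻¹c_R¹)`, `χ = √(γ⁻¹γ⁻¹)` (the cross pair: the structure-`0` divergence is a row of the weight), `w₀ = √(c_R⁰∕γ₀)` —
`𝔊ᵢ = frakGLin G₁ᵢ Qᵢ Qᵢ† Kᵢ⁻¹ Dᵢ Rᵢ D*ᵢ` (`B11Eq111FrakG`).  `C` is linear in the small letters `Θ, δ_Q, δ_P, δ_D, δ_R`; no operator bound of `Δ_a`, `D`,
`Δ_a¹ − Δ_a⁰`, no Neumann series, no volume. [cite: Balaban1985BackgroundPropagators, (3.153) p.426, Thm 3.13 p.426, Thm 3.4 p.400, Thm 3.11 p.416;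
Balaban1985Variational, (45) p.285] -/
theorem norm_apply_frakG_sub_le (P : E →ₗ[𝕜] V) (hP : ∀ w : E, ‖P w‖ ≤ N w) (x : E) :
    ‖P (frakGLin (G1K Δ₁ D₁ R₁ Dstar₁ Q₁ (LinearMap.adjoint Q₁) a hpos₁) Q₁ (LinearMap.adjoint Q₁) (KinvK hpos₁ hadj₁ hinj₁) D₁ R₁ Dstar₁ x -
        frakGLin (G1K Δ₀ D₀ R₀ Dstar₀ Q₀ (LinearMap.adjoint Q₀) a hpos₀) Q₀ (LinearMap.adjoint Q₀) (KinvK hpos₀ hadj₀ hinj₀) D₀ R₀ Dstar₀ x)‖ ≤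
      (Θ / γ * γ₀⁻¹ +
        (((Θ * Real.sqrt (C₀ / γ₀) + δQ * C₀) / γ + Real.sqrt (C₁ / γ) * (δQ * Real.sqrt (C₀ / γ₀))) * MQ * γ⁻¹ +
          Real.sqrt (C₀ / γ₀) * (δQ * γ⁻¹ + MQ * (Θ / γ) * γ₀⁻¹)) +
        (Real.sqrt (γ⁻¹ * cR₁) * (δP * γ⁻¹ + MP * (Θ / γ) * γ₀⁻¹) +
          (γ⁻¹ * δD * MR + Real.sqrt (γ⁻¹ * γ⁻¹) * δR + Θ / γ * Real.sqrt (cR₀ / γ₀)) * MP * γ₀⁻¹)) * ‖x‖ := by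
  -- the row `P` and the structure-`0` divergence are dominated by the energy of structure `1`
  have hP2 : ∀ w : E, ‖P w‖ ^ 2 ≤ γ⁻¹ * RCLike.re ⟪w, laplaceAK Δ₁ D₁ R₁ Dstar₁ Q₁ (LinearMap.adjoint Q₁) a w⟫_𝕜 := by
    intro w
    rw [← div_eq_inv_mul, le_div_iff₀ hγ, mul_comm]
    calc γ * ‖P w‖ ^ 2 ≤ γ * N w ^ 2 := mul_le_mul_of_nonneg_left (pow_le_pow_left₀ (norm_nonneg _) (hP w) 2) hγ.le
      _ ≤ _ := hcoer₁ w
  have hDs2 : ∀ w : E, ‖Dstar₀ w‖ ^ 2 ≤ γ⁻¹ * RCLike.re ⟪w, laplaceAK Δ₁ D₁ R₁ Dstar₁ Q₁ (LinearMap.adjoint Q₁) a w⟫_𝕜 := by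
    intro w
    rw [← div_eq_inv_mul, le_div_iff₀ hγ, mul_comm]
    calc γ * ‖Dstar₀ w‖ ^ 2 ≤ γ * N w ^ 2 := mul_le_mul_of_nonneg_left (pow_le_pow_left₀ (norm_nonneg _) (hDs₀ w) 2) hγ.le
      _ ≤ _ := hcoer₁ w
  have hPP₁ : ∀ (x : E) (s : S), ⟪(R₁ ∘ₗ Dstar₁) x, s⟫_𝕜 = ⟪x, (D₁ ∘ₗ R₁) s⟫_𝕜 := B9Eq3153FrakGVariational.inner_RDstar_eq hDD₁ hRsym₁
  have hPP₀ : ∀ (x : E) (s : S), ⟪(R₀ ∘ₗ Dstar₀) x, s⟫_𝕜 = ⟪x, (D₀ ∘ₗ R₀) s⟫_𝕜 := B9Eq3153FrakGVariational.inner_RDstar_eq hDD₀ hRsym₀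
  have hXP : ∀ (x : E) (s : S), ⟪Dstar₀ x, s⟫_𝕜 = ⟪x, D₀ s⟫_𝕜 := by
    intro x s; rw [← inner_conj_symm, ← hDD₀, inner_conj_symm]
  have hRD₁' : ∀ x : E, ‖(R₁ ∘ₗ Dstar₁) x‖ ^ 2 ≤ cR₁ * RCLike.re ⟪x, laplaceAK Δ₁ D₁ R₁ Dstar₁ Q₁ (LinearMap.adjoint Q₁) a x⟫_𝕜 := fun x => hRD₁ x
  have hRD₀' : ∀ x : E, ‖(R₀ ∘ₗ Dstar₀) x‖ ^ 2 ≤ cR₀ * RCLike.re ⟪x, laplaceAK Δ₀ D₀ R₀ Dstar₀ Q₀ (LinearMap.adjoint Q₀) a x⟫_𝕜 := fun x => hRD₀ x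
  -- the piece letters
  have hGd : ∀ y : E, N (G1K Δ₀ D₀ R₀ Dstar₀ Q₀ (LinearMap.adjoint Q₀) a hpos₀ y - G1K Δ₁ D₁ R₁ Dstar₁ Q₁ (LinearMap.adjoint Q₁) a hpos₁ y) ≤
      Θ / γ * N (G1K Δ₀ D₀ R₀ Dstar₀ Q₀ (LinearMap.adjoint Q₀) a hpos₀ y) := fun y =>
    weight_green_sub_le hpos₀ hpos₁ N hN hγ hΘ hcoer₁ hT y
  have hG0 : ∀ y : E, N (G1K Δ₀ D₀ R₀ Dstar₀ Q₀ (LinearMap.adjoint Q₀) a hpos₀ y) ≤ γ₀⁻¹ * ‖y‖ := fun y =>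
    weight_green_le hpos₀ N hN hNn hγ₀ hcoer₀ y
  have hG1 : ∀ y : E, N (G1K Δ₁ D₁ R₁ Dstar₁ Q₁ (LinearMap.adjoint Q₁) a hpos₁ y) ≤ γ⁻¹ * ‖y‖ := fun y =>
    weight_green_le hpos₁ N hN hNn hγ hcoer₁ y
  have hHd : ∀ b : F, ‖P (H1K hpos₁ hadj₁ hinj₁ b - H1K hpos₀ hadj₀ hinj₀ b)‖ ≤
      ((Θ * Real.sqrt (C₀ / γ₀) + δQ * C₀) / γ + Real.sqrt (C₁ / γ) * (δQ * Real.sqrt (C₀ / γ₀))) * ‖b‖ := fun b =>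
    norm_apply_H1K_sub_le hpos₀ hadj₀ hinj₀ hpos₁ hadj₁ hinj₁ N hN hNn hγ hγ₀ hΘ hδQ hC₀ hC₁ hcoer₁ hcoer₀ hT hQd hK₀ hK₁ P hP b
  have hH0 : ∀ c : F, N (H1K hpos₀ hadj₀ hinj₀ c) ≤ Real.sqrt (C₀ / γ₀) * ‖c‖ := fun c =>
    weight_H1K_le hpos₀ hadj₀ hinj₀ N hN hγ₀ hC₀ hcoer₀ hK₀ c
  have hA1 : ∀ t : S, ‖P (G1K Δ₁ D₁ R₁ Dstar₁ Q₁ (LinearMap.adjoint Q₁) a hpos₁ (D₁ (R₁ t)))‖ ≤ Real.sqrt (γ⁻¹ * cR₁) * ‖t‖ := by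
    intro t
    have h := norm_apply_G1K_adj_le' hpos₁ (R₁ ∘ₗ Dstar₁) hcR₁ hRD₁' (D₁ ∘ₗ R₁) hPP₁ P (inv_nonneg.2 hγ.le) hP2 t
    rwa [LinearMap.comp_apply] at h
  have hX : ∀ r : S, ‖P (G1K Δ₁ D₁ R₁ Dstar₁ Q₁ (LinearMap.adjoint Q₁) a hpos₁ (D₀ r))‖ ≤ Real.sqrt (γ⁻¹ * γ⁻¹) * ‖r‖ := fun r =>
    norm_apply_G1K_adj_le' hpos₁ Dstar₀ (inv_nonneg.2 hγ.le) hDs2 D₀ hXP P (inv_nonneg.2 hγ.le) hP2 r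
  have hW0 : ∀ t : S, N (G1K Δ₀ D₀ R₀ Dstar₀ Q₀ (LinearMap.adjoint Q₀) a hpos₀ (D₀ (R₀ t))) ≤ Real.sqrt (cR₀ / γ₀) * ‖t‖ := by
    intro t
    have h := weight_G1K_adj_le hpos₀ N hN hγ₀ hcoer₀ (R₀ ∘ₗ Dstar₀) hcR₀ hRD₀' (D₀ ∘ₗ R₀) hPP₀ t
    rwa [LinearMap.comp_apply] at h
  rw [frakGLin_apply_H1K, frakGLin_apply_H1K]
  exact norm_apply_frakG_sub_le_of_pieces (G1K Δ₀ D₀ R₀ Dstar₀ Q₀ (LinearMap.adjoint Q₀) a hpos₀) (G1K Δ₁ D₁ R₁ Dstar₁ Q₁ (LinearMap.adjoint Q₁) a hpos₁)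
    (H1K hpos₀ hadj₀ hinj₀) (H1K hpos₁ hadj₁ hinj₁) Q₀ Q₁ D₀ D₁ R₀ R₁ Dstar₀ Dstar₁ P N hNn hP (div_nonneg hΘ hγ.le) (inv_nonneg.2 hγ.le) (by positivity)
    (by positivity) hMQ hδQ hδP hMP (by positivity) (by positivity) hδD hδR hMR (by positivity) hGd hG0 hG1 hHd hH0 hQ1 hQ0 hQd hPd hP0 hA1 hX hDd hRd hR1
    hW0 hRR₀ hRR₁ x

end Discharge

end Literature.MathematicalPhysics.QuantumFieldTheory.Balaban1983to89.B9Eq3153FrakGLipschitzEnergy
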